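import Mathlib.Tactic.Abel
import Mathlib.Tactic.Group
import Literature.Combinatorics.Additive.TripleProductProperty
import Summits.MatrixMultiplication.OmegaCensus.DihedralLikeLaw
import Summits.MatrixMultiplication.OmegaCensus.DihedralLikeFamily
import HarnessLib

/-!
# Saturation of TPP triples by a central involution; periodicity of two-two law triples at `c₀ ≠ 0`

ω-census, family (b3).  Framing: lottery ticket; floor = certified bounds/negative ranges.

**Lemma (`tpp_saturate`).** Let `z` be central with `z² = 1`, and let `(S, T, U)` satisfy the triple product property
(the tree's right-quotient form).  If the non-trivial right quotients of `S` and of `T` are stable under multiplication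
by `z` (for `s ≠ s'` in `S` there are `r ≠ r'` in `S` with `s s'⁻¹ z = r r'⁻¹`, and likewise for `T`), then
`(S, T, U ∪ U z)` again satisfies the TPP.  (If `x x'⁻¹ y y'⁻¹ w w'⁻¹ = 1` with `w, w'` from `U ∪ Uz`, the `U`-quotient
is `u u'⁻¹` or `u u'⁻¹ z`; in the second case a non-trivial `S`- or `T`-quotient would absorb the `z` and contradict the
TPP, so `x = x'`, `y = y'` and `u u'⁻¹ = z`, which is exactly `w = w'`.)

**Application (`parts_periodic_of_two_two_law`).** In a dihedral-like group `G(A, c₀)` every coset element squares to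
`z = ρ(c₀)`, which is central with `z² = 1`, and a *domino* `X = {ρa, τb}` has non-trivial quotients
`{τ(b−a), τ(b−a+c₀)} = {q, qz}`.  Hence for a TPP triple `(S, T, U)` with `S, T` dominoes, `(S, T, U ∪ Uρ(c₀))` is TPP;
if the triple attains the mod-one law `3|S||T||U| + 8 = 8|A|` (`|A| ≡ 1 (mod 3)`), maximality (`DihedralLikeLaw.lean`)
forces `U ρ(c₀) = U`: **both coset parts of `U` are `c₀`-periodic.**  For `c₀ ≠ 0` this is the extra structure that
makes `A/⟨c₀⟩` cyclic (`DicyclicLawQuotientCyclicTwoTwo.lean`).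
-/

namespace Summit.MatrixMultiplication.OmegaCensus

open Literature.Combinatorics.Additive Finset

section General

variable {G : Type*} [Group G] [DecidableEq G]

/-- **Saturation by a central involution.** See the module docstring. [folklore] -/
theorem tpp_saturate {S T U : Finset G} {z : G} (hz : ∀ g : G, Commute z g) (hzz : z * z = 1)
    (hS : ∀ s ∈ S, ∀ s' ∈ S, s ≠ s' → ∃ r ∈ S, ∃ r' ∈ S, r ≠ r' ∧ s * s'⁻¹ * z = r * r'⁻¹)
    (hT : ∀ t ∈ T, ∀ t' ∈ T, t ≠ t' → ∃ r ∈ T, ∃ r' ∈ T, r ≠ r' ∧ t * t'⁻¹ * z = r * r'⁻¹)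
    (h : TripleProductProperty S T U) :
    TripleProductProperty S T (U ∪ U.image (· * z)) := by
  have hzinv : z⁻¹ = z := inv_eq_of_mul_eq_one_right hzz
  have comm : ∀ g : G, z * g = g * z := fun g => (hz g).eq
  have E1 : ∀ g : G, (g * z)⁻¹ = g⁻¹ * z := fun g => by rw [mul_inv_rev, hzinv, comm]
  -- the twisted equation forces `s = s'`, `t = t'`, `u u'⁻¹ = z`
  have aux : ∀ s ∈ S, ∀ s' ∈ S, ∀ t ∈ T, ∀ t' ∈ T, ∀ u ∈ U, ∀ u' ∈ U,
      s * s'⁻¹ * (t * t'⁻¹) * (u * u'⁻¹) * z = 1 → s = s' ∧ t = t' ∧ u * u'⁻¹ = z := by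
    intro s hs s' hs' t ht t' ht' u hu u' hu' heq
    by_cases hss : s = s'
    · subst hss
      by_cases htt : t = t'
      · subst htt
        refine ⟨rfl, rfl, ?_⟩
        rw [mul_inv_cancel, mul_inv_cancel, one_mul, one_mul] at heq
        rw [← hzinv]; exact eq_inv_of_mul_eq_one_left heq
      · exfalso
        obtain ⟨r, hr, r', hr', hrr, hq⟩ := hT t ht t' ht' htt
        have heq' : s * s⁻¹ * (r * r'⁻¹) * (u * u'⁻¹) = 1 := by
          rw [← hq, ← heq]; simp only [mul_assoc, comm]
        obtain ⟨-, hrr', -⟩ := h s hs s hs r hr r' hr' u hu u' hu' heq'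
        exact hrr hrr'
    · exfalso
      obtain ⟨r, hr, r', hr', hrr, hq⟩ := hS s hs s' hs' hss
      have heq' : r * r'⁻¹ * (t * t'⁻¹) * (u * u'⁻¹) = 1 := by
        rw [← hq, ← heq]; simp only [mul_assoc, comm]
      obtain ⟨hrr', -, -⟩ := h r hr r' hr' t ht t' ht' u hu u' hu' heq'
      exact hrr hrr'
  intro x hx x' hx' y hy y' hy' w hw w' hw' heq
  rw [mem_union, mem_image] at hw hw'
  rcases hw with hw | ⟨u, hu, rfl⟩ <;> rcases hw' with hw' | ⟨u', hu', rfl⟩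
  · exact h x hx x' hx' y hy y' hy' w hw w' hw' heq
  · -- `w ∈ U`, `w' = u' z`
    rw [E1, ← mul_assoc w, ← mul_assoc (x * x'⁻¹ * (y * y'⁻¹))] at heq
    obtain ⟨hxx, hyy, hwu⟩ := aux x hx x' hx' y hy y' hy' w hw u' hu' heq
    refine ⟨hxx, hyy, ?_⟩
    calc w = w * u'⁻¹ * u' := by group
      _ = z * u' := by rw [hwu]
      _ = u' * z := (hz u').eq
  · -- `w = u z`, `w' ∈ U`
    rw [mul_assoc u z, (hz w'⁻¹).eq, ← mul_assoc u, ← mul_assoc (x * x'⁻¹ * (y * y'⁻¹))] at heq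
    obtain ⟨hxx, hyy, hwu⟩ := aux x hx x' hx' y hy y' hy' u hu w' hw' heq
    refine ⟨hxx, hyy, ?_⟩
    calc u * z = u * w'⁻¹ * w' * z := by group
      _ = z * w' * z := by rw [hwu]
      _ = w' * (z * z) := by rw [(hz w').eq, mul_assoc]
      _ = w' := by rw [hzz, mul_one]
  · -- `w = u z`, `w' = u' z`
    rw [E1, mul_assoc u z, ← mul_assoc z, (hz u'⁻¹).eq, mul_assoc u'⁻¹, hzz, mul_one] at heq
    obtain ⟨hxx, hyy, huu⟩ := h x hx x' hx' y hy y' hy' u hu u' hu' heq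
    exact ⟨hxx, hyy, by rw [huu]⟩

end General

section DihedralLike

variable {A : Type*} [AddCommGroup A] [DecidableEq A] [Fintype A] {G : Type} [Group G] [DecidableEq G]
  {ρ τ : A → G} {c₀ : A} {S T U : Finset G}

omit [DecidableEq A] [Fintype A] [DecidableEq G] in
/-- `ρ(c₀)` is central in a dihedral-like group. [folklore] -/
theorem commute_rho_c0 (hρρ : ∀ a b, ρ a * ρ b = ρ (a + b)) (hρτ : ∀ a b, ρ a * τ b = τ (b - a))
    (hτρ : ∀ a b, τ a * ρ b = τ (a + b)) (hττ : ∀ a b, τ a * τ b = ρ (c₀ + b - a)) (hτ : Function.Injective τ)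
    (hsurj : ∀ g, (∃ a, ρ a = g) ∨ (∃ a, τ a = g)) (g : G) : Commute (ρ c₀) g := by
  have h2c := two_c0_eq_zero hρτ hτρ hττ hτ
  rcases hsurj g with ⟨a, rfl⟩ | ⟨a, rfl⟩
  · show ρ c₀ * ρ a = ρ a * ρ c₀
    rw [hρρ, hρρ, add_comm]
  · show ρ c₀ * τ a = τ a * ρ c₀
    rw [hρτ, hτρ]; congr 1
    rw [sub_eq_iff_eq_add, add_assoc, h2c, add_zero]

omit [DecidableEq A] [Fintype A] [DecidableEq G] in
/-- `ρ(c₀)² = 1`. [folklore] -/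
theorem rho_c0_mul_self (hρρ : ∀ a b, ρ a * ρ b = ρ (a + b)) (hρτ : ∀ a b, ρ a * τ b = τ (b - a))
    (hτρ : ∀ a b, τ a * ρ b = τ (a + b)) (hττ : ∀ a b, τ a * τ b = ρ (c₀ + b - a)) (hτ : Function.Injective τ) :
    ρ c₀ * ρ c₀ = 1 := by
  rw [hρρ, two_c0_eq_zero hρτ hτρ hττ hτ, rho_zero hρρ]

omit [DecidableEq A] in
/-- **A domino's non-trivial quotients are `ρ(c₀)`-stable.** If `X` meets each coset in exactly one element
(`X = {ρa, τb}`), then for `x ≠ x'` in `X` there are `r ≠ r'` in `X` with `x x'⁻¹ ρ(c₀) = r r'⁻¹`. [folklore] -/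
theorem domino_quot_stable (hρρ : ∀ a b, ρ a * ρ b = ρ (a + b)) (hρτ : ∀ a b, ρ a * τ b = τ (b - a))
    (hτρ : ∀ a b, τ a * ρ b = τ (a + b)) (hττ : ∀ a b, τ a * τ b = ρ (c₀ + b - a))
    (hτ : Function.Injective τ) (hne : ∀ a b, ρ a ≠ τ b)
    (hsurj : ∀ g, (∃ a, ρ a = g) ∨ (∃ a, τ a = g)) {X : Finset G}
    (hX₀ : (univ.filter fun a : A => ρ a ∈ X).card = 1) (hX₁ : (univ.filter fun a : A => τ a ∈ X).card = 1) :
    ∀ x ∈ X, ∀ x' ∈ X, x ≠ x' → ∃ r ∈ X, ∃ r' ∈ X, r ≠ r' ∧ x * x'⁻¹ * ρ c₀ = r * r'⁻¹ := by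
  have h2c := two_c0_eq_zero hρτ hτρ hττ hτ
  obtain ⟨a, ha⟩ := card_eq_one.1 hX₀
  obtain ⟨b, hb⟩ := card_eq_one.1 hX₁
  have ma : ρ a ∈ X := by
    have hm := mem_singleton_self a; rw [← ha] at hm; exact (mem_filter.1 hm).2
  have mb : τ b ∈ X := by
    have hm := mem_singleton_self b; rw [← hb] at hm; exact (mem_filter.1 hm).2
  -- every element of `X` is `ρa` or `τb`
  have hmem : ∀ x ∈ X, x = ρ a ∨ x = τ b := by
    intro x hx
    rcases hsurj x with ⟨a', rfl⟩ | ⟨b', rfl⟩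
    · left
      have : a' ∈ univ.filter fun a : A => ρ a ∈ X := mem_filter.2 ⟨mem_univ _, hx⟩
      rw [ha, mem_singleton] at this; rw [this]
    · right
      have : b' ∈ univ.filter fun a : A => τ a ∈ X := mem_filter.2 ⟨mem_univ _, hx⟩
      rw [hb, mem_singleton] at this; rw [this]
  have invρ := inv_rho hρρ
  have invτ := inv_tau hρρ hττ
  intro x hx x' hx' hxx
  rcases hmem x hx with rfl | rfl <;> rcases hmem x' hx' with rfl | rfl
  · exact absurd rfl hxx
  · refine ⟨τ b, mb, ρ a, ma, fun h => hne a b h.symm, ?_⟩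
    rw [invτ, invρ, hρτ, hτρ, hτρ]; congr 1; abel
  · refine ⟨ρ a, ma, τ b, mb, hne a b, ?_⟩
    rw [invρ, invτ, hτρ, hτρ, hρτ]; congr 1
    linear_combination (norm := abel1) h2c
  · exact absurd rfl hxx

/-- **Two-two law triples at any `c₀`: the big set is `c₀`-periodic.** Dihedral-like `G` over `A`
(`|A| ≡ 1 (mod 3)`, `|A| ≥ 7`); a TPP triple with `S`, `T` dominoes (one element in each coset) attaining
`3|S||T||U| + 8 = 8|A|` has both coset parts of `U` invariant under `+ c₀`. [folklore] -/
theorem parts_periodic_of_two_two_law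
    (hρρ : ∀ a b, ρ a * ρ b = ρ (a + b)) (hρτ : ∀ a b, ρ a * τ b = τ (b - a))
    (hτρ : ∀ a b, τ a * ρ b = τ (a + b)) (hττ : ∀ a b, τ a * τ b = ρ (c₀ + b - a))
    (hρ : Function.Injective ρ) (hτ : Function.Injective τ) (hne : ∀ a b, ρ a ≠ τ b)
    (hsurj : ∀ g, (∃ a, ρ a = g) ∨ (∃ a, τ a = g)) (hmod : Fintype.card A % 3 = 1) (hA : 7 ≤ Fintype.card A)
    (h : TripleProductProperty S T U)
    (hs₀ : (univ.filter fun a : A => ρ a ∈ S).card = 1) (hs₁ : (univ.filter fun a : A => τ a ∈ S).card = 1)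
    (ht₀ : (univ.filter fun a : A => ρ a ∈ T).card = 1) (ht₁ : (univ.filter fun a : A => τ a ∈ T).card = 1)
    (hV : 3 * (S.card * T.card * U.card) + 8 = 8 * Fintype.card A) :
    (univ.filter fun a : A => ρ a ∈ U).image (· + c₀) = (univ.filter fun a : A => ρ a ∈ U) ∧
      (univ.filter fun a : A => τ a ∈ U).image (· + c₀) = (univ.filter fun a : A => τ a ∈ U) := by
  set z : G := ρ c₀ with hz
  have hzc : ∀ g, Commute z g := commute_rho_c0 hρρ hρτ hτρ hττ hτ hsurj
  have hzz : z * z = 1 := rho_c0_mul_self hρρ hρτ hτρ hττ hτ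
  have hsat := tpp_saturate hzc hzz (domino_quot_stable hρρ hρτ hτρ hττ hτ hne hsurj hs₀ hs₁)
    (domino_quot_stable hρρ hρτ hτρ hττ hτ hne hsurj ht₀ ht₁) h
  have hle := tpp_volume_le_law_dihedralLike_mod_one hρρ hρτ hτρ hττ hρ hτ hne hsurj hmod hA hsat
  have cS : S.card = 2 := by rw [card_eq_parts' hρ hτ hne hsurj S, hs₀, hs₁]
  have cT : T.card = 2 := by rw [card_eq_parts' hρ hτ hne hsurj T, ht₀, ht₁]
  rw [cS, cT] at hV hle
  have hUU : (U ∪ U.image (· * z)).card ≤ U.card := by omega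
  have hsub : U.image (· * z) ⊆ U := fun x hx =>
    (eq_of_subset_of_card_le subset_union_left hUU).symm ▸ mem_union_right _ hx
  have memz : ∀ x ∈ U, x * z ∈ U := fun x hx => hsub (mem_image_of_mem _ hx)
  constructor
  · apply eq_of_subset_of_card_le _ (by rw [card_image_of_injective _ (add_left_injective c₀)])
    intro x hx
    obtain ⟨a, ha, rfl⟩ := mem_image.1 hx
    refine mem_filter.2 ⟨mem_univ _, ?_⟩
    have := memz _ (mem_filter.1 ha).2
    rwa [hz, hρρ] at this
  · apply eq_of_subset_of_card_le _ (by rw [card_image_of_injective _ (add_left_injective c₀)])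
    intro x hx
    obtain ⟨a, ha, rfl⟩ := mem_image.1 hx
    refine mem_filter.2 ⟨mem_univ _, ?_⟩
    have := memz _ (mem_filter.1 ha).2
    rwa [hz, hτρ] at this

end DihedralLike

end Summit.MatrixMultiplication.OmegaCensus
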